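import Mathlib.Analysis.InnerProductSpace.PiL2
import Mathlib.Analysis.Normed.Operator.LinearIsometry
import Mathlib.Tactic
import Literature.MathematicalPhysics.StatisticalMechanics.BarlowStackingWindowRebase
import Literature.MathematicalPhysics.StatisticalMechanics.LennardJonesClusters
import Summits.AtomisticToContinuum.Crystallization.Theorems.MinMeanCycleStackingLockBarlowEnergyIdentification

/-!
# Crux `HcpLandscapeGap` (route `HullExactificationCascade`, stmt-AtomisticToContinuum-12087),
# line `birth`: stub `stub_chargeToBadBond` (G2) — charging sites near a bad bond

Pure counting for windows of exact rigid images of uniform Barlow stackings.  A *window* is an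
injective enumeration `x : Fin n → ℝ³` of `S ∩ B̄_L(c)`, `S = v + B '' barlowStacking a h s`
(`B` a linear isometry), and `m t, i t, j t` are the layer / in-layer indices of `x t`.  For
every `K : ℕ` there are `M = (3K + 7)³` and `ρ = K + 2` such that the window sites within `K`
layers of a *bad bond* `k` (`s (k + 1) = s k`) number at most
`M · #{window sites ON a bad-bond layer} + #{window sites of depth < ρ}`:

* for such a site `x t` and bad bond `k`, `|k − m t| ≤ K`, layer `k` carries a stacking point
  `q` within `|(k − m t) h| + 2 ≤ K + 2` of the preimage of `x t`
  (`exists_barlowPos_dist_le_of_layer`; `0 < h ≤ 17/20 · a ≤ 1`), and the rigid motion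
  `w ↦ v + B w` preserves distances;
* if `dist (v + B q) c ≤ L` then `v + B q = x t'` is a window site, on the layer `m t' = k`
  (`barlowPos_injective`), within `K + 2` of `x t` — charge `t` to `t'`;
* otherwise `dist (x t) c > L − (K + 2)` (triangle inequality) — `x t` is a boundary site;
* the window sites within `K + 2` of a fixed `x t'` are `min a h ≥ 7/10`-separated
  (`le_dist_of_mem_barlowStacking`), so they number `≤ (2(K + 2)/(7/10) + 1)³ ≤ (3K + 7)³`
  (`card_le_of_separated_of_dist_le`, `finrank_euclideanSpace_fin`).

All `[folklore]`.
-/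

noncomputable section

namespace Summit.AtomisticToContinuum.Crystallization.Theorems.HcpLandscapeGapBirth

open Literature.MathematicalPhysics.StatisticalMechanics

/-! ## The fibre bound -/

/-- **Fibre bound.** If `x : Fin n → ℝ³` is an injective family of points of a rigid image
`v + B '' barlowStacking a h s` of a Barlow stacking with `a, h ≥ 7/10`, then any finite set of
indices whose points lie within `R ≥ 0` of a point `p` has at most `(2R/(7/10) + 1)³` elements:
the points are `min a h ≥ 7/10`-separated (`le_dist_of_mem_barlowStacking`; the rigid motion
preserves distances) and the packing bound `card_le_of_separated_of_dist_le` applies in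
`ℝ³ = EuclideanSpace ℝ (Fin 3)` (`finrank = 3`). [folklore] -/
theorem card_le_of_window_fibre {a h : ℝ} (ha : 7 / 10 ≤ a) (hh : 7 / 10 ≤ h) (s : ℤ → ℤ)
    (B : EuclideanSpace ℝ (Fin 3) →ₗᵢ[ℝ] EuclideanSpace ℝ (Fin 3)) (v : EuclideanSpace ℝ (Fin 3))
    {n : ℕ} {x : Fin n → EuclideanSpace ℝ (Fin 3)} (hx : Function.Injective x)
    (hxS : ∀ t : Fin n, ∃ w ∈ barlowStacking a h s, x t = v + B w) {R : ℝ} (hR : 0 ≤ R)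
    (p : EuclideanSpace ℝ (Fin 3)) (F : Finset (Fin n)) (hF : ∀ t ∈ F, dist (x t) p ≤ R) :
    (F.card : ℝ) ≤ (2 * R / (7 / 10) + 1) ^ 3 := by
  classical
  have hcard : (F.image x).card = F.card := Finset.card_image_of_injective F hx
  have hs : ∀ c ∈ F.image x, dist c p ≤ R := by
    intro c hc
    obtain ⟨t, ht, rfl⟩ := Finset.mem_image.1 hc
    exact hF t ht
  have hsep : ∀ c ∈ F.image x, ∀ d ∈ F.image x, c ≠ d → (7 / 10 : ℝ) ≤ dist c d := by
    intro c hc d hd hcd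
    obtain ⟨t, -, rfl⟩ := Finset.mem_image.1 hc
    obtain ⟨t', -, rfl⟩ := Finset.mem_image.1 hd
    obtain ⟨w, hw, hxt⟩ := hxS t
    obtain ⟨w', hw', hxt'⟩ := hxS t'
    have hne : w ≠ w' := by
      rintro rfl
      exact hcd (hxt.trans hxt'.symm)
    rw [hxt, hxt', dist_add_left, LinearIsometry.dist_map]
    calc (7 / 10 : ℝ) ≤ min a h := le_min ha hh
      _ ≤ dist w w' :=
        le_dist_of_mem_barlowStacking a h s (by linarith) (by linarith) hw hw' hne
  have h1 := card_le_of_separated_of_dist_le (F.image x) p (r := 7 / 10) (R := R)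
    (by norm_num) hR hs hsep
  rw [finrank_euclideanSpace_fin, hcard] at h1
  exact h1

/-! ## The stub -/

/-- **Stub G2 — charging sites near a bad bond to bad-bond layers or to the boundary.**  For
every `K` there are `M = (3K + 7)³` and `ρ = K + 2 ≥ 0` such that for `(a, h)` in the box
`47/50 ≤ a ≤ 1`, `39/50 · a ≤ h ≤ 17/20 · a`, any word `s`, any rigid motion `w ↦ v + B w` and
any window `x` (injective enumeration of the image points within `L` of `c`, with indices
`m, i, j`): the window sites within `K` layers of a bad bond number at most
`M · #{t | s (m t + 1) = s (m t)} + #{t | L − ρ < dist (x t) c}`.  For `t` with a bad bond `k`,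
`|k − m t| ≤ K`, `exists_barlowPos_dist_le_of_layer` gives a stacking point of layer `k` within
`K·h + 2 ≤ K + 2` of `x t`; if its image lies in the ball it is some `x t'` with `m t' = k`
(`barlowPos_injective`), else `dist (x t) c > L − (K + 2)`; the fibres of `t ↦ t'` have `≤ M`
points (`card_le_of_window_fibre`). [folklore] -/
theorem stub_chargeToBadBond : (∀ K : ℕ, ∃ M : ℕ, ∃ ρ : ℝ, 0 ≤ ρ ∧ ∀ (a h : ℝ), 47 / 50 ≤ a → a ≤ 1 → 39 / 50 * a ≤ h → h ≤ 17 / 20 * a → ∀ (s : ℤ → ℤ) (B : EuclideanSpace ℝ (Fin 3) →ₗᵢ[ℝ] EuclideanSpace ℝ (Fin 3)) (v c : EuclideanSpace ℝ (Fin 3)) (L : ℝ) (n : ℕ) (x : Fin n → EuclideanSpace ℝ (Fin 3)), Function.Injective x → Set.range x = {y : EuclideanSpace ℝ (Fin 3) | y ∈ (fun w => v + B w) '' Literature.MathematicalPhysics.StatisticalMechanics.barlowStacking a h s ∧ dist y c ≤ L} → ∀ (m i j : Fin n → ℤ), (∀ t : Fin n, x t = v + B (Literature.MathematicalPhysics.StatisticalMechanics.barlowPos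 a h s (m t) (i t) (j t))) → Nat.card {t : Fin n // ∃ k : ℤ, |k - m t| ≤ K ∧ s (k + 1) = s k} ≤ M * Nat.card {t : Fin n // s (m t + 1) = s (m t)} + Nat.card {t : Fin n // L - ρ < dist (x t) c}) := by
  classical
  intro K
  refine ⟨(3 * K + 7) ^ 3, (K : ℝ) + 2, by positivity, ?_⟩
  intro a h ha ha1 hha hh17 s B v c L n x hx hrange m i j hxm
  -- the scales
  have ha0 : 0 < a := by linarith
  have hh0 : 0 < h := by linarith
  have hh1 : h ≤ 1 := by linarith
  have ha7 : (7 / 10 : ℝ) ≤ a := by linarith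
  have hh7 : (7 / 10 : ℝ) ≤ h := by linarith
  have hK0 : (0 : ℝ) ≤ K := Nat.cast_nonneg K
  -- the finite sets of indices
  set Near : Finset (Fin n) :=
    Finset.univ.filter fun t => ∃ k : ℤ, |k - m t| ≤ K ∧ s (k + 1) = s k with hNear
  set Earn : Finset (Fin n) := Finset.univ.filter fun t => s (m t + 1) = s (m t) with hEarn
  set Bnd : Finset (Fin n) :=
    Finset.univ.filter fun t => L - ((K : ℝ) + 2) < dist (x t) c with hBnd
  set Fib : Fin n → Finset (Fin n) :=
    fun t' => Finset.univ.filter fun t => dist (x t) (x t') ≤ (K : ℝ) + 2 with hFib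
  have hN : Nat.card {t : Fin n // ∃ k : ℤ, |k - m t| ≤ K ∧ s (k + 1) = s k} = Near.card :=
    Nat.subtype_card Near (by simp [hNear])
  have hE : Nat.card {t : Fin n // s (m t + 1) = s (m t)} = Earn.card :=
    Nat.subtype_card Earn (by simp [hEarn])
  have hB : Nat.card {t : Fin n // L - ((K : ℝ) + 2) < dist (x t) c} = Bnd.card :=
    Nat.subtype_card Bnd (by simp [hBnd])
  rw [hN, hE, hB]
  -- the charging: every near site is within `K + 2` of a bad-bond-layer site, or a boundary site
  have hincl : Near ⊆ Earn.biUnion Fib ∪ Bnd := by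
    intro t ht
    obtain ⟨k, hk, hsk⟩ := (Finset.mem_filter.1 ht).2
    obtain ⟨i₁, j₁, hd⟩ :=
      exists_barlowPos_dist_le_of_layer a h s ha0.le ha1 k (m t) (i t) (j t)
    -- the layer-`k` point is within `K + 2` of the preimage of `x t`
    have hkK : |(k : ℝ) - m t| ≤ K := by exact_mod_cast hk
    have hKh : |((k : ℝ) - m t) * h| + 2 ≤ (K : ℝ) + 2 := by
      rw [abs_mul, abs_of_pos hh0]
      nlinarith [abs_nonneg ((k : ℝ) - m t)]
    set q : EuclideanSpace ℝ (Fin 3) := barlowPos a h s k i₁ j₁ with hq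
    have hdist : dist (x t) (v + B q) ≤ (K : ℝ) + 2 := by
      rw [hxm t, dist_add_left, LinearIsometry.dist_map, dist_comm]
      exact hd.trans hKh
    by_cases hc : dist (v + B q) c ≤ L
    · -- `v + B q` is a window site `x t'`, on layer `k`
      have hmem : v + B q ∈ Set.range x := by
        rw [hrange]
        exact ⟨⟨q, barlowPos_mem _ _ _, rfl⟩, hc⟩
      obtain ⟨t', ht'⟩ := hmem
      have hlayer : m t' = k := by
        have h0 : v + B (barlowPos a h s (m t') (i t') (j t')) = v + B q := (hxm t').symm.trans ht'
        have h1 : barlowPos a h s (m t') (i t') (j t') = q := B.injective (add_left_cancel h0)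
        have h2 : ((m t', i t', j t') : ℤ × ℤ × ℤ) = (k, i₁, j₁) := barlowPos_injective ha0 hh0 s h1
        exact congrArg Prod.fst h2
      refine Finset.mem_union_left _ (Finset.mem_biUnion.2 ⟨t', ?_, ?_⟩)
      · exact Finset.mem_filter.2 ⟨Finset.mem_univ _, by rw [hlayer]; exact hsk⟩
      · exact Finset.mem_filter.2 ⟨Finset.mem_univ _, by rw [ht']; exact hdist⟩
    · -- `x t` lies in the boundary layer of depth `K + 2`
      push Not at hc
      refine Finset.mem_union_right _ (Finset.mem_filter.2 ⟨Finset.mem_univ _, ?_⟩)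
      have htri := dist_triangle (v + B q) (x t) c
      rw [dist_comm (v + B q) (x t)] at htri
      linarith
  -- the fibres of the charging have at most `(3K + 7)³` points
  have hfib : ∀ t' ∈ Earn, (Fib t').card ≤ (3 * K + 7) ^ 3 := by
    intro t' _
    have h1 : ((Fib t').card : ℝ) ≤ (2 * ((K : ℝ) + 2) / (7 / 10) + 1) ^ 3 :=
      card_le_of_window_fibre ha7 hh7 s B v hx (fun t => ⟨_, barlowPos_mem _ _ _, hxm t⟩)
        (by positivity) (x t') (Fib t') fun t ht => (Finset.mem_filter.1 ht).2
    have h2 : 2 * ((K : ℝ) + 2) / (7 / 10) + 1 ≤ 3 * (K : ℝ) + 7 := by linarith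
    have h3 : (2 * ((K : ℝ) + 2) / (7 / 10) + 1) ^ 3 ≤ ((3 * K + 7 : ℕ) : ℝ) ^ 3 := by
      push_cast
      exact pow_le_pow_left₀ (by positivity) h2 3
    exact_mod_cast h1.trans h3
  calc Near.card ≤ (Earn.biUnion Fib ∪ Bnd).card := Finset.card_le_card hincl
    _ ≤ (Earn.biUnion Fib).card + Bnd.card := Finset.card_union_le _ _
    _ ≤ Earn.card * (3 * K + 7) ^ 3 + Bnd.card :=
      Nat.add_le_add_right (Finset.card_biUnion_le_card_mul _ _ _ hfib) _
    _ = (3 * K + 7) ^ 3 * Earn.card + Bnd.card := by ring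

end Summit.AtomisticToContinuum.Crystallization.Theorems.HcpLandscapeGapBirth

end
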